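import Literature.Topology.FourManifolds.HandlebodySymmetryLeaves
import Literature.Topology.FourManifolds.OneHandleStepExists
import HarnessLib

/-!
# Every handlebody admits an orientation-reversing symmetry (F2b₂) — discharged

Topic `Literature/Topology/FourManifolds`; fact seat
`provefact-Literature.Topology.FourManifolds.IsHandlebody.exists_diffeomorph_isOrientationReversing_boundary`
(F2b₂ of the Lickorish–Wallace DAG, `LickorishWallaceSphereGluing.lean`; Juhász, *Differential
and Low-Dimensional Topology* (2023), §3.5, p. 97: "every handlebody admits an
orientation-reversing symmetry").

`HandlebodySymmetryLeaves.lean` proves F2b₂ from the uniqueness of attaching one `1`-handle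
alone (L1, `Literature.Topology.FourManifolds.oneHandle_nonempty_diffeomorph`; Milnor (1965),
Thm. 3.13; Kosinski (1993), VI (6.6), (11.4)(c)):
`IsHandlebody.exists_diffeomorph_isOrientationReversing_boundary_of_oneHandle` — the symmetric
models `exists_isHandlebody_isOrientationReversing_holds` of `HandlebodySymmetricModels.lean`
(reflection of a thickened planar wedge of `g` circles), transported along the classification of
handlebodies `IsHandlebody.nonempty_diffeomorph_of_oneHandle` (`LickorishWallaceLeaves.lean`).
L1 being now a theorem of the tree (`oneHandle_nonempty_diffeomorph_holds`,
`OneHandleStepExists.lean`), this file records the closed discharge.  Nothing else is declared.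

## References

* A. Juhász, *Differential and Low-Dimensional Topology*, LMS Student Texts 104 (2023), §3.5,
  p. 97 (Definition 3.27 and the remark after Proposition 3.28). [Juhasz2023]
* J. Milnor, *Lectures on the h-cobordism theorem* (1965), Thm. 3.13. [MilnorHCobordism1965]
* A. A. Kosinski, *Differential Manifolds* (1993), VI (6.6), (11.4)(c). [Kosinski1993]
-/

open scoped Manifold ContDiff Topology

noncomputable section

namespace Literature.Topology.FourManifolds

universe u

/-- **Every handlebody admits an orientation-reversing symmetry (F2b₂ holds)**: for a genus-`g`
handlebody `H` (`Literature.Topology.FourManifolds.IsHandlebody`) with boundary datum `b` there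
are an orientation `o` of `∂H`, a self-diffeomorphism `R` of `H` and a self-diffeomorphism `r` of
`∂H` with `R ∘ incl = incl ∘ r` and `r` reversing `o` (Juhász (2023), §3.5, p. 97: "every
handlebody admits an orientation-reversing symmetry" — the reflection of `♮^g (S¹ × D²) ⊆ ℝ³` in a
plane containing the cores of the handles, transported to the abstract handlebody along the
classification of handlebodies).  From
`IsHandlebody.exists_diffeomorph_isOrientationReversing_boundary_of_oneHandle` and
`oneHandle_nonempty_diffeomorph_holds`. [cite: Juhasz2023, §3.5 (p. 97)] -/
theorem IsHandlebody.exists_diffeomorph_isOrientationReversing_boundary_holds :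
    IsHandlebody.exists_diffeomorph_isOrientationReversing_boundary.{u} :=
  IsHandlebody.exists_diffeomorph_isOrientationReversing_boundary_of_oneHandle
    oneHandle_nonempty_diffeomorph_holds

end Literature.Topology.FourManifolds
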